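import Summits.PneNP.PneNP.Theses.ORIncompressibility
import Summits.PneNP.PneNP.Theorems.ORIncompressibilityAssembly
import Summits.PneNP.PneNP.Theorems.ORIncompressibilityOneBitCompressorOfNPSubsetP
import Summits.PneNP.PneNP.Theorems.NPNotSubsetPPoly
import Literature.Computability.Complexity.ClayProblem
import Literature.Computability.Complexity.ClayProblemProofs
import Literature.Computability.Complexity.ClayProblemConsequences
import Literature.Computability.Complexity.InstanceCompression
import Literature.Computability.Complexity.InstanceCompressionProofs
import Literature.Computability.Complexity.AdviceBasics
import Literature.Computability.Complexity.NPClosureProofs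
import Literature.Computability.Complexity.NondeterministicProofs
import Literature.Computability.Complexity.ProbabilisticClasses
import Literature.Computability.Complexity.ProbabilisticClassesProofs
import Literature.Computability.Complexity.CircuitClassesUniformProofs

/-!
# BC2(c) cheap probes — crux `NoORCompression` (stmt-PneNP-0985)

The instruction's probe `example : Xᵢ → S / Xᵢ → X := by first | exact? | simpa [Xᵢ] | (unfold Xᵢ; simpa) | aesop`
run against the TREE (route file, the route's landed Theorems, the complexity Literature — but NOT the
census companion `StrategyCensus.lean`, so that `exact?` sees only landed lemmas). Every chain ends in
`| sorry`, so the file elaborates and **the sorry count is the number of FAILED probes**; a probe that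
succeeds leaves no sorry on its line. Pieces are re-declared here verbatim from `StrategyCensus.lean`.

`X := NoORCompression`, `S := PneNP`.
-/

set_option linter.dupNamespace false
set_option autoImplicit false
set_option linter.unusedTactic false
set_option linter.unreachableTactic false

namespace Summit.PneNP.PneNP.Cruxes.NoORCompression.Probes

open Filter
open Literature.Computability.Complexity
open Summit.PneNP.PneNP.Theses.ORIncompressibility

/-! ### The pieces (verbatim copies of the census definitions) -/

def SliceAt (a : ℕ) : Prop :=
  ∃ c : ℕ, ∀ f ∈ FP, ∃ᶠ n : ℕ in atTop, ∃ xs ys : List (List Bool),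
    (xs.length = n ^ c ∧ ∀ x ∈ xs, x.length = n) ∧ (ys.length = n ^ c ∧ ∀ y ∈ ys, y.length = n) ∧
    (n ^ a < (f (xs.foldr boolPair [])).length ∨
      (f (xs.foldr boolPair []) = f (ys.foldr boolPair []) ∧
        ¬ ((∃ x ∈ xs, x ∈ SAT) ↔ ∃ y ∈ ys, y ∈ SAT)))

def Tail2 : Prop := ∀ a : ℕ, 2 ≤ a → SliceAt a

def T_FS : Prop := ¬ (coNP ⊆ polyAdvice Nondeterministic.NP)
def B_FS : Prop := ¬ NoORCompression → coNP ⊆ polyAdvice Nondeterministic.NP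
def T_D : Prop := ¬ (Nondeterministic.NP ⊆ co AM)
def B_D : Prop := ¬ NoORCompression → Nondeterministic.NP ⊆ co AM
def T_3 : Prop := Nondeterministic.NP ≠ coNP
def T_4 : Prop := ¬ (Nondeterministic.NP ⊆ coNP)
def DerandomisedArthur : Prop :=
  ¬ NoORCompression → Nondeterministic.NP ⊆ co AM → Nondeterministic.NP ⊆ coNP

def W_TC0 : Prop :=
  ∀ d k c c' : ℕ, c' < c → ∃ᶠ n : ℕ in atTop, ∀ m ≤ n ^ c', ∀ C : Fin m → Circuit (Fin (n ^ c * n)),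
    (∀ j, (C j).IsOver tcBasis ∧ (C j).acDepth ≤ d ∧ (C j).size ≤ (n ^ c * n) ^ k) →
    ∃ x y : Fin (n ^ c * n) → Bool, (∀ j, (C j).eval x = (C j).eval y) ∧
      ¬ ((∃ i : Fin (n ^ c), List.ofFn (fun l : Fin n => x (finProdFinEquiv (i, l))) ∈ SAT) ↔
        ∃ i : Fin (n ^ c), List.ofFn (fun l : Fin n => y (finProdFinEquiv (i, l))) ∈ SAT)
def B_TC0 : Prop := ¬ NoORCompression → ¬ W_TC0

def CheapORCompressible (q c : ℕ) : Prop :=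
  ∀ᶠ n : ℕ in atTop, ∃ m : ℕ, m ^ q ≤ n ^ c * n ∧ ∃ C : Fin m → Circuit (Fin (n ^ c * n)),
    (∀ j, (C j).IsOver B2) ∧ (∑ j, (C j).size) ^ q ≤ (n ^ c * n) ^ (q + 1) ∧
    ∀ x y : Fin (n ^ c * n) → Bool, (∀ j, (C j).eval x = (C j).eval y) →
      ((∃ i : Fin (n ^ c), List.ofFn (fun l : Fin n => x (finProdFinEquiv (i, l))) ∈ SAT) ↔
        ∃ i : Fin (n ^ c), List.ofFn (fun l : Fin n => y (finProdFinEquiv (i, l))) ∈ SAT)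
def X_B : Prop :=
  ¬ NoORCompression → ∀ q : ℕ, 0 < q → ∃ c₀ : ℕ, ∀ c : ℕ, c₀ ≤ c → CheapORCompressible q c
def X_A : Prop :=
  ∃ q : ℕ, 0 < q ∧ ∀ c₀ : ℕ, ∃ c : ℕ, c₀ ≤ c ∧ ¬ CheapORCompressible q c

def X_nu : Prop :=
  ∀ a : ℕ, ∃ c : ℕ, ∀ k : ℕ, ∃ᶠ n : ℕ in atTop, ∀ m ≤ n ^ a, ∀ C : Fin m → Circuit (Fin (n ^ c * n)),
    (∀ j, (C j).IsOver B2 ∧ (C j).size ≤ (n ^ c * n) ^ k) →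
    ∃ x y : Fin (n ^ c * n) → Bool, (∀ j, (C j).eval x = (C j).eval y) ∧
      ¬ ((∃ i : Fin (n ^ c), List.ofFn (fun l : Fin n => x (finProdFinEquiv (i, l))) ∈ SAT) ↔
        ∃ i : Fin (n ^ c), List.ofFn (fun l : Fin n => y (finProdFinEquiv (i, l))) ∈ SAT)

/-! ### P0 the crux against the summit -/


-- P0a  X → S in the tree-only context (exact? must chain `closes` with two landed item proofs)
set_option maxHeartbeats 400000 in
example : NoORCompression → _root_.PneNP := by
  first
    | exact?
    | simpa [NoORCompression]
    | (unfold NoORCompression; simpa)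
    | aesop (config := { terminal := true })
    | sorry

-- P0b  S → X (expected FAIL: X is the stronger statement)
set_option maxHeartbeats 400000 in
example : _root_.PneNP → NoORCompression := by
  first
    | exact?
    | simpa [NoORCompression]
    | (unfold NoORCompression; simpa)
    | aesop (config := { terminal := true })
    | sorry

-- P0c  X → S given the two LANDED items as hypotheses (expected SUCCESS by name: `closes`)
set_option maxHeartbeats 400000 in
example (h₁ : Assembly) (h₂ : OneBitCompressorOfNPSubsetP) : NoORCompression → _root_.PneNP := by
  first
    | exact?
    | simpa
    | aesop (config := { terminal := true })
    | sorry

/-! ### D1 Fortnow–Santhanam bridge: T_FS ∧ B_FS -/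


-- P1a  T_FS → S (in truth ≥ S: census `pneNP_of_not_coNP_subset_polyAdvice_NP`, 6 lines)
set_option maxHeartbeats 400000 in
example : T_FS → _root_.PneNP := by
  first
    | exact?
    | simpa [T_FS]
    | (unfold T_FS; simpa)
    | aesop (config := { terminal := true })
    | sorry

-- P1b  T_FS → X
set_option maxHeartbeats 400000 in
example : T_FS → NoORCompression := by
  first
    | exact?
    | simpa [T_FS]
    | (unfold T_FS; simpa)
    | aesop (config := { terminal := true })
    | sorry

-- P1c  B_FS → S
set_option maxHeartbeats 400000 in
example : B_FS → _root_.PneNP := by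
  first
    | exact?
    | simpa [B_FS]
    | (unfold B_FS; simpa)
    | aesop (config := { terminal := true })
    | sorry

-- P1d  B_FS → X
set_option maxHeartbeats 400000 in
example : B_FS → NoORCompression := by
  first
    | exact?
    | simpa [B_FS]
    | (unfold B_FS; simpa)
    | aesop (config := { terminal := true })
    | sorry

-- P1e  seam T_FS → B_FS → X (expected SUCCESS: trivial seam)
set_option maxHeartbeats 400000 in
example : T_FS → B_FS → NoORCompression := by
  first
    | exact?
    | simpa [T_FS, B_FS]
    | (unfold T_FS B_FS; simpa)
    | aesop (config := { terminal := true })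
    | (unfold T_FS B_FS; tauto)
    | sorry

/-! ### D2 Drucker bridge: T_D ∧ B_D -/


-- P2a  T_D → S (in truth ≥ S: census `pneNP_of_not_NP_subset_coAM`, 8 lines)
set_option maxHeartbeats 400000 in
example : T_D → _root_.PneNP := by
  first
    | exact?
    | simpa [T_D]
    | (unfold T_D; simpa)
    | aesop (config := { terminal := true })
    | sorry

-- P2b  T_D → X
set_option maxHeartbeats 400000 in
example : T_D → NoORCompression := by
  first
    | exact?
    | simpa [T_D]
    | (unfold T_D; simpa)
    | aesop (config := { terminal := true })
    | sorry

-- P2c  B_D → S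
set_option maxHeartbeats 400000 in
example : B_D → _root_.PneNP := by
  first
    | exact?
    | simpa [B_D]
    | (unfold B_D; simpa)
    | aesop (config := { terminal := true })
    | sorry

-- P2d  B_D → X
set_option maxHeartbeats 400000 in
example : B_D → NoORCompression := by
  first
    | exact?
    | simpa [B_D]
    | (unfold B_D; simpa)
    | aesop (config := { terminal := true })
    | sorry

-- P2e  seam T_D → B_D → X (expected SUCCESS)
set_option maxHeartbeats 400000 in
example : T_D → B_D → NoORCompression := by
  first
    | exact?
    | simpa [T_D, B_D]
    | (unfold T_D B_D; simpa)
    | aesop (config := { terminal := true })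
    | (unfold T_D B_D; tauto)
    | sorry

/-! ### D3 the route's own crux #3: NP ≠ coNP ∧ CompressionCollapse -/


-- P3a  T_3 → S (in truth ≥ S: census `pneNP_of_NP_ne_coNP`, 3 lines)
set_option maxHeartbeats 400000 in
example : T_3 → _root_.PneNP := by
  first
    | exact?
    | simpa [T_3]
    | (unfold T_3; simpa)
    | aesop (config := { terminal := true })
    | sorry

-- P3b  T_3 → X
set_option maxHeartbeats 400000 in
example : T_3 → NoORCompression := by
  first
    | exact?
    | simpa [T_3]
    | (unfold T_3; simpa)
    | aesop (config := { terminal := true })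
    | sorry

-- P3c  CompressionCollapse → S
set_option maxHeartbeats 400000 in
example : CompressionCollapse → _root_.PneNP := by
  first
    | exact?
    | simpa [CompressionCollapse]
    | (unfold CompressionCollapse; simpa)
    | aesop (config := { terminal := true })
    | sorry

-- P3d  CompressionCollapse → X
set_option maxHeartbeats 400000 in
example : CompressionCollapse → NoORCompression := by
  first
    | exact?
    | simpa [CompressionCollapse]
    | (unfold CompressionCollapse; simpa)
    | aesop (config := { terminal := true })
    | sorry

-- P3e  seam T_3 → CompressionCollapse → X (expected SUCCESS)
set_option maxHeartbeats 400000 in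
example : T_3 → CompressionCollapse → NoORCompression := by
  first
    | exact?
    | simpa [T_3, CompressionCollapse]
    | (unfold T_3 CompressionCollapse; simpa)
    | aesop (config := { terminal := true })
    | (unfold T_3 CompressionCollapse; tauto)
    | sorry

/-! ### D4 uniformisation chain: B_D ∧ DerandomisedArthur ∧ T_4 -/


-- P4a  T_4 → S (in truth ≥ S: census `pneNP_of_not_NP_subset_coNP`)
set_option maxHeartbeats 400000 in
example : T_4 → _root_.PneNP := by
  first
    | exact?
    | simpa [T_4]
    | (unfold T_4; simpa)
    | aesop (config := { terminal := true })
    | sorry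

-- P4b  T_4 → X
set_option maxHeartbeats 400000 in
example : T_4 → NoORCompression := by
  first
    | exact?
    | simpa [T_4]
    | (unfold T_4; simpa)
    | aesop (config := { terminal := true })
    | sorry

-- P4c  DerandomisedArthur → S
set_option maxHeartbeats 400000 in
example : DerandomisedArthur → _root_.PneNP := by
  first
    | exact?
    | simpa [DerandomisedArthur]
    | (unfold DerandomisedArthur; simpa)
    | aesop (config := { terminal := true })
    | sorry

-- P4d  DerandomisedArthur → X
set_option maxHeartbeats 400000 in
example : DerandomisedArthur → NoORCompression := by
  first
    | exact?
    | simpa [DerandomisedArthur]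
    | (unfold DerandomisedArthur; simpa)
    | aesop (config := { terminal := true })
    | sorry

-- P4e  seam B_D → DerandomisedArthur → T_4 → X (expected SUCCESS)
set_option maxHeartbeats 400000 in
example : B_D → DerandomisedArthur → T_4 → NoORCompression := by
  first
    | exact?
    | simpa [B_D, DerandomisedArthur, T_4]
    | (unfold B_D DerandomisedArthur T_4; simpa)
    | aesop (config := { terminal := true })
    | (unfold B_D DerandomisedArthur T_4; tauto)
    | sorry

/-! ### D5 slicing over the budget: SliceAt 1 ∧ Tail2 -/


-- P5a  SliceAt 1 → S (in truth ≥ S: census `pneNP_of_sliceAt_one`, 15 lines)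
set_option maxHeartbeats 400000 in
example : SliceAt 1 → _root_.PneNP := by
  first
    | exact?
    | simpa [SliceAt]
    | (unfold SliceAt; simpa)
    | aesop (config := { terminal := true })
    | sorry

-- P5b  SliceAt 1 → X
set_option maxHeartbeats 400000 in
example : SliceAt 1 → NoORCompression := by
  first
    | exact?
    | simpa [SliceAt]
    | (unfold SliceAt; simpa)
    | aesop (config := { terminal := true })
    | sorry

-- P5c  Tail2 → S
set_option maxHeartbeats 400000 in
example : Tail2 → _root_.PneNP := by
  first
    | exact?
    | simpa [Tail2]
    | (unfold Tail2; simpa)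
    | aesop (config := { terminal := true })
    | sorry

-- P5d  Tail2 → X (in truth ⟺ X: census `tail_iff`, via `sliceAt_anti`)
set_option maxHeartbeats 400000 in
example : Tail2 → NoORCompression := by
  first
    | exact?
    | simpa [Tail2]
    | (unfold Tail2; simpa)
    | aesop (config := { terminal := true })
    | sorry

-- P5e  X → SliceAt 1 (a CONSEQUENCE of X; closed by the explicit one-liner — `exact?` also finds it, but on
--      P5f its suggested term trips a kernel "declaration has metavariables" error in this Lean, so both
--      consequence probes are recorded with the explicit term)
example : NoORCompression → SliceAt 1 := fun h => h 1

-- P5f  X → Tail2 (a CONSEQUENCE of X; explicit one-liner)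
example : NoORCompression → Tail2 := fun h a _ => h a

/-! ### D7 TC⁰ lower bound + "compressors can be made shallow": W_TC0 ∧ B_TC0 -/


-- P7a  W_TC0 → S
set_option maxHeartbeats 400000 in
example : W_TC0 → _root_.PneNP := by
  first
    | exact?
    | simpa [W_TC0]
    | (unfold W_TC0; simpa)
    | aesop (config := { terminal := true })
    | sorry

-- P7b  W_TC0 → X
set_option maxHeartbeats 400000 in
example : W_TC0 → NoORCompression := by
  first
    | exact?
    | simpa [W_TC0]
    | (unfold W_TC0; simpa)
    | aesop (config := { terminal := true })
    | sorry

-- P7c  B_TC0 → S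
set_option maxHeartbeats 400000 in
example : B_TC0 → _root_.PneNP := by
  first
    | exact?
    | simpa [B_TC0]
    | (unfold B_TC0; simpa)
    | aesop (config := { terminal := true })
    | sorry

-- P7d  B_TC0 → X
set_option maxHeartbeats 400000 in
example : B_TC0 → NoORCompression := by
  first
    | exact?
    | simpa [B_TC0]
    | (unfold B_TC0; simpa)
    | aesop (config := { terminal := true })
    | sorry

-- P7e  seam W_TC0 → B_TC0 → X (expected SUCCESS)
set_option maxHeartbeats 400000 in
example : W_TC0 → B_TC0 → NoORCompression := by
  first
    | exact?
    | simpa [B_TC0]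
    | (unfold B_TC0; simpa)
    | aesop (config := { terminal := true })
    | (unfold B_TC0; tauto)
    | sorry

/-! ### D8 magnification: X_A ∧ X_B -/


-- P8a  X_A → S (in truth ≥ NP ⊄ P/poly ≥ S via the trivial compressor; not cheaply)
set_option maxHeartbeats 400000 in
example : X_A → _root_.PneNP := by
  first
    | exact?
    | simpa [X_A]
    | (unfold X_A; simpa)
    | aesop (config := { terminal := true })
    | sorry

-- P8b  X_A → X
set_option maxHeartbeats 400000 in
example : X_A → NoORCompression := by
  first
    | exact?
    | simpa [X_A]
    | (unfold X_A; simpa)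
    | aesop (config := { terminal := true })
    | sorry

-- P8c  X_B → S
set_option maxHeartbeats 400000 in
example : X_B → _root_.PneNP := by
  first
    | exact?
    | simpa [X_B]
    | (unfold X_B; simpa)
    | aesop (config := { terminal := true })
    | sorry

-- P8d  X_B → X
set_option maxHeartbeats 400000 in
example : X_B → NoORCompression := by
  first
    | exact?
    | simpa [X_B]
    | (unfold X_B; simpa)
    | aesop (config := { terminal := true })
    | sorry

-- P8e  seam X_A → X_B → X (five lines of logic; explicit proof offered last)
set_option maxHeartbeats 400000 in
example : X_A → X_B → NoORCompression := by
  first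
    | exact?
    | simpa [X_A, X_B]
    | (unfold X_A X_B; simpa)
    | aesop (config := { terminal := true })
    | (intro hA hB; by_contra hX; obtain ⟨q, hq, hA'⟩ := hA; obtain ⟨c₀, hc₀⟩ := hB hX q hq; obtain ⟨c, hc, hnc⟩ := hA' c₀; exact hnc (hc₀ c hc))
    | sorry

/-! ### D9 the non-uniform strengthening X_nu as a piece -/


-- P9a  X_nu → S
set_option maxHeartbeats 400000 in
example : X_nu → _root_.PneNP := by
  first
    | exact?
    | simpa [X_nu]
    | (unfold X_nu; simpa)
    | aesop (config := { terminal := true })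
    | sorry

-- P9b  X_nu → X (in truth X_nu ⇒ X via `FP ⊆ P/poly` for string functions; not landed)
set_option maxHeartbeats 400000 in
example : X_nu → NoORCompression := by
  first
    | exact?
    | simpa [X_nu]
    | (unfold X_nu; simpa)
    | aesop (config := { terminal := true })
    | sorry

/-! ### P10 standard hypotheses against the summit, by name in the tree? -/


-- P10a  NP ⊄ P/poly → S (the landed `NPNotSubsetPPoly.P_ne_NP` needs the fact `P_subset_PPoly` and concludes `P ≠ NP`)
set_option maxHeartbeats 400000 in
example : Summit.PneNP.PneNP.NPNotSubsetPPoly → _root_.PneNP := by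
  first
    | exact?
    | simpa [Summit.PneNP.PneNP.NPNotSubsetPPoly]
    | (unfold Summit.PneNP.PneNP.NPNotSubsetPPoly; simpa)
    | aesop (config := { terminal := true })
    | sorry

-- P10b  T_FS refutes the PRINTED compressibility hypothesis by the landed FS theorem (explicit term offered last)
set_option maxHeartbeats 400000 in
example : T_FS → ¬ ∃ f ∈ FP, ∃ (A : Set (List Bool)) (p : Polynomial ℕ), IsORCompression SAT f A fun n => p.eval n := by
  first
    | exact?
    | simpa [T_FS]
    | (unfold T_FS; simpa)
    | aesop (config := { terminal := true })
    | (exact fun hT h => hT (orSAT_compressible_imp_coNP_subset_polyAdvice_NP_holds h))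
    | sorry

-- P10c  coNP ⊄ NP/poly → NP ≠ coNP? (cheaply: no)
set_option maxHeartbeats 400000 in
example : T_FS → T_3 := by
  first
    | exact?
    | simpa [T_FS, T_3]
    | (unfold T_FS T_3; simpa)
    | aesop (config := { terminal := true })
    | sorry

end Summit.PneNP.PneNP.Cruxes.NoORCompression.Probes
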